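import Literature.NumberTheory.LFunctions.AutomaticSequenceTransducerGroup
import HarnessLib

/-!
# Arithmetic restrictions for the naturally induced transducer, I: the numbers `[w]_k` and `d(q, q̄)` (Müllner 2017, Lemma 2.17; proved)

Everything in this file is PROVED (plus plain definitions). It begins §2.4 of C. Müllner,
*Automatic sequences fulfill the Sarnak conjecture* (Duke Math. J. 166 (2017)) for the transducer
`MinImage δ` over the digit alphabet (letters `≥ k` acting trivially, `htriv`), period
`d = transducerPeriod k δ`:

* `wordVal k w = [w]_k` (most significant digit first), `wordVal_append`, injectivity on digit
  words of a fixed length;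
* `MinImage.pathVals k M M' g L` — the numbers `[w]_k` of the digit paths `w ∈ Σ^L` from `M` to `M'`
  with output `g`; `MinImage.diffGcd k M M' g L = d_{g,ℓ}^{q q̄}` for `L = dℓ` — the gcd of all
  differences of such numbers (Müllner's "equivalent definition");
* `diffGcd_ne_zero` (from Lemma 2.13: two different paths give two different numbers) and
  **Lemma 2.17, core divisibility** (`diffGcd_add_dvd`): `d_{g₁, ℓ+ℓ'} ∣ d_{g₂, ℓ}` for `ℓ' ≥ m₀`
  (prefix a loop of length `dℓ'` with output `g₁ g₂⁻¹`, Thm. 2.7 (2));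
* **Lemma 2.17, stabilisation** (`exists_diffGcd_eq`): there are `D = d(q,q̄) > 0` and `m₀'` with
  `d_{g,ℓ} = D` for all `g ∈ G_{q q̄}(0)` and `ℓ ≥ m₀'`.

The remaining lemmas of §2.4 (2.18–2.24: `ℓ₀`, `d'`, `d''`, `k₀`, `s₀`, `G₀`) and Thm. 2.16 are
not formalised here.

## References
* C. Müllner, Duke Math. J. 166 (2017), §2.4, Lemma 2.17 (and the definition of `d_{g,ℓ}^{q q̄}`).
  [Mullner2017]
-/

noncomputable section

open Finset

namespace Literature.NumberTheory.LFunctions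

/-! ## The number denoted by a word -/

/-- `[w]_k`: the number whose base-`k` expansion, most significant digit first, is `w`
(Müllner §1.1). [cite: Mullner2017, §1.1] -/
def wordVal (k : ℕ) (w : List ℕ) : ℕ :=
  Nat.ofDigits k w.reverse

/-- `[u v]_k = [u]_k k^{|v|} + [v]_k`. [folklore] -/
theorem wordVal_append (k : ℕ) (u v : List ℕ) :
    wordVal k (u ++ v) = wordVal k u * k ^ v.length + wordVal k v := by
  rw [wordVal, wordVal, wordVal, List.reverse_append, Nat.ofDigits_append, List.length_reverse]
  ring

/-- `[·]_k` is injective on digit words of a fixed length. [folklore] -/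
theorem wordVal_injOn {k : ℕ} (hk : 1 < k) {u v : List ℕ} (hu : ∀ d ∈ u, d < k)
    (hv : ∀ d ∈ v, d < k) (hlen : u.length = v.length) (h : wordVal k u = wordVal k v) : u = v := by
  have := Nat.ofDigits_inj_of_len_eq hk (by simpa using hlen)
    (fun d hd => hu d (List.mem_reverse.1 hd)) (fun d hd => hv d (List.mem_reverse.1 hd)) h
  exact List.reverse_injective this

namespace MinImage

variable {σ : Type*} [Fintype σ] [DecidableEq σ] {δ : σ → ℕ → σ} {k : ℕ}

/-! ## The numbers of the paths with prescribed output, and `d_{g,ℓ}` -/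

/-- The numbers `[w]_k` of the digit paths `w ∈ Σ^L` from `M` to `M'` with output `g`.
[cite: Mullner2017, §2.4 (definition of d_{g,ℓ})] -/
def pathVals (k : ℕ) (M M' : MinImage δ) (g : Equiv.Perm (Fin (minRank δ))) (L : ℕ) : Set ℕ :=
  {x | ∃ w : List ℕ, (∀ d ∈ w, d < k) ∧ w.length = L ∧ M.next w = M' ∧ M.T w = g ∧ wordVal k w = x}

/-- `d_{g,ℓ}^{q q̄}` (for length `L`): the gcd of all differences of numbers of paths of length `L`
from `M` to `M'` with output `g` (Müllner's "equivalent definition"; `0` if there are fewer than two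
such numbers). [cite: Mullner2017, §2.4 (definition of d_{g,ℓ})] -/
def diffGcd (k : ℕ) (M M' : MinImage δ) (g : Equiv.Perm (Fin (minRank δ))) (L : ℕ) : ℕ :=
  Nat.setGcd {z | ∃ x ∈ M.pathVals k M' g L, ∃ y ∈ M.pathVals k M' g L, y ≤ x ∧ z = x - y}

/-- Prefixing a loop at `M`: numbers shift by `[w]_k k^L` and the output is multiplied on the left.
[folklore] -/
theorem mem_pathVals_append {M M' : MinImage δ} {g : Equiv.Perm (Fin (minRank δ))} {L : ℕ} {x : ℕ}
    (hx : x ∈ M.pathVals k M' g L) {w : List ℕ} (hw : ∀ d ∈ w, d < k) (hnext : M.next w = M) :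
    wordVal k w * k ^ L + x ∈ M.pathVals k M' ((M.T w).trans g) (w.length + L) := by
  obtain ⟨v, hvd, hvl, hvn, hvT, rfl⟩ := hx
  refine ⟨w ++ v, digits_append hw hvd, by rw [List.length_append, hvl], ?_, ?_, ?_⟩
  · rw [next_append, hnext, hvn]
  · rw [T_append, hnext, hvT]
  · rw [wordVal_append, hvl]

/-- **Müllner 2017, Lemma 2.17, core divisibility**: `d_{g₁, L'+L} ∣ d_{g₂, L}` whenever a digit
loop `w` at `M` of length `L'` with `T(M, w) ≫ g₂ = g₁` exists — every difference of numbers for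
`(g₂, L)` is a difference of numbers for `(g₁, L' + L)`. [cite: Mullner2017, Lemma 2.17] -/
theorem diffGcd_dvd_of_loop {M M' : MinImage δ} {g₁ g₂ : Equiv.Perm (Fin (minRank δ))} {L L' : ℕ}
    {w : List ℕ} (hw : ∀ d ∈ w, d < k) (hwl : w.length = L') (hnext : M.next w = M)
    (hT : (M.T w).trans g₂ = g₁) :
    M.diffGcd k M' g₁ (L' + L) ∣ M.diffGcd k M' g₂ L := by
  rw [diffGcd, diffGcd, Nat.dvd_setGcd_iff]
  rintro z ⟨x, hx, y, hy, hyx, rfl⟩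
  refine Nat.setGcd_dvd_of_mem ⟨wordVal k w * k ^ L + x, ?_, wordVal k w * k ^ L + y, ?_, by omega,
    by omega⟩
  · have := mem_pathVals_append hx hw hnext
    rwa [hT, hwl] at this
  · have := mem_pathVals_append hy hw hnext
    rwa [hT, hwl] at this

/-- The outputs of two paths between the same states in the same class differ by a loop:
`g₁ ≫ g₂⁻¹ ∈ G_q`. [cite: Mullner2017, Lemma 2.11] -/
theorem trans_symm_mem_loopGroup (hk : 0 < k) (htriv : ∀ q d, k ≤ d → δ q d = q)
    {M M' : MinImage δ} {c : ZMod (transducerPeriod k δ)} {g₁ g₂ : Equiv.Perm (Fin (minRank δ))}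
    (h₁ : g₁ ∈ M.pathOutputs k M' c) (h₂ : g₂ ∈ M.pathOutputs k M' c) :
    g₁.trans g₂.symm ∈ M.loopGroup hk htriv := by
  rw [mem_loopGroup]
  have := trans_mem_pathOutputs h₁ (symm_mem_pathOutputs hk htriv h₂)
  rwa [add_neg_cancel] at this

/-- **Müllner 2017, Lemma 2.17, divisibility** ("`d_{g₁,ℓ+ℓ'} | d_{g₂,ℓ}` for `ℓ' ≥ m₀`"): for
outputs `g₁, g₂` of paths from `M` to `M'` in the same class and all large `ℓ'`,
`d_{g₁, ℓ'd + L} ∣ d_{g₂, L}` (realise `g₁ g₂⁻¹ ∈ G_q` by a loop of length `ℓ' d`, Thm. 2.7 (2)).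
[cite: Mullner2017, Lemma 2.17] -/
theorem exists_forall_diffGcd_dvd (hk : 0 < k) (htriv : ∀ q d, k ≤ d → δ q d = q) (M : MinImage δ) :
    ∃ m₀ : ℕ, ∀ (M' : MinImage δ) (c : ZMod (transducerPeriod k δ))
      (g₁ g₂ : Equiv.Perm (Fin (minRank δ))), g₁ ∈ M.pathOutputs k M' c → g₂ ∈ M.pathOutputs k M' c →
      ∀ n : ℕ, m₀ ≤ n → ∀ L : ℕ,
        M.diffGcd k M' g₁ (n * transducerPeriod k δ + L) ∣ M.diffGcd k M' g₂ L := by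
  obtain ⟨m₀, hm₀⟩ := M.exists_forall_exists_loop_eq hk htriv
  refine ⟨m₀, fun M' c g₁ g₂ h₁ h₂ n hn L => ?_⟩
  obtain ⟨w, hwd, hwl, hnext, hT⟩ := hm₀ n hn _ (trans_symm_mem_loopGroup hk htriv h₁ h₂)
  refine diffGcd_dvd_of_loop hwd hwl hnext ?_
  rw [hT, Equiv.trans_assoc, Equiv.symm_trans_self, Equiv.trans_refl]

/-- **`d_{g,ℓ} ≠ 0` for large `ℓ`** (Müllner: by Lemma 2.13 there are two different paths; different
digit words of the same length denote different numbers), `k ≥ 2`. [cite: Mullner2017, §2.4] -/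
theorem exists_forall_diffGcd_ne_zero (hk : 2 ≤ k) (htriv : ∀ q d, k ≤ d → δ q d = q) :
    ∃ m₀ : ℕ, ∀ (M M' : MinImage δ) (c : ZMod (transducerPeriod k δ))
      (g : Equiv.Perm (Fin (minRank δ))), g ∈ M.pathOutputs k M' c → ∀ K : ℕ, m₀ ≤ K →
        M.diffGcd k M' g (c.val + K * transducerPeriod k δ) ≠ 0 := by
  have hk1 : 1 < k := hk
  obtain ⟨m₀, hm₀⟩ := exists_two_paths hk htriv (δ := δ)
  refine ⟨m₀, fun M M' c g hg K hK => ?_⟩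
  obtain ⟨w₁, w₂, hne, h₁d, h₂d, h₁l, h₂l, h₁n, h₂n, h₁T, h₂T⟩ := hm₀ M M' c g hg K hK
  have hval : wordVal k w₁ ≠ wordVal k w₂ := fun h =>
    hne (wordVal_injOn hk1 h₁d h₂d (h₁l.trans h₂l.symm) h)
  rw [diffGcd, Ne, Nat.setGcd_eq_zero_iff, Set.subset_def]
  intro hsub
  have hx : wordVal k w₁ ∈ M.pathVals k M' g (c.val + K * transducerPeriod k δ) :=
    ⟨w₁, h₁d, h₁l, h₁n, h₁T, rfl⟩
  have hy : wordVal k w₂ ∈ M.pathVals k M' g (c.val + K * transducerPeriod k δ) :=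
    ⟨w₂, h₂d, h₂l, h₂n, h₂T, rfl⟩
  rcases le_or_gt (wordVal k w₂) (wordVal k w₁) with h | h
  · have := hsub _ ⟨_, hx, _, hy, h, rfl⟩
    rw [Set.mem_singleton_iff] at this
    omega
  · have := hsub _ ⟨_, hy, _, hx, h.le, rfl⟩
    rw [Set.mem_singleton_iff] at this
    omega

/-- **Müllner 2017, Lemma 2.17 (stabilisation of `d_{g,ℓ}`)**: for `k ≥ 2` and states `M, M'` and a
class `c` there are `D > 0` ("`d(q, q̄)`", here possibly depending on the class) and `m₀'` such
that `d_{g,ℓ} = D` for every `g ∈ G_{q q̄}(c)` and every length `ℓ = c.val + K d` with `K ≥ m₀'`.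
[cite: Mullner2017, Lemma 2.17] -/
theorem exists_diffGcd_eq (hk : 2 ≤ k) (htriv : ∀ q d, k ≤ d → δ q d = q) (M M' : MinImage δ)
    (c : ZMod (transducerPeriod k δ)) :
    ∃ D : ℕ, 0 < D ∧ ∃ m₀' : ℕ, ∀ g ∈ M.pathOutputs k M' c, ∀ K : ℕ, m₀' ≤ K →
      M.diffGcd k M' g (c.val + K * transducerPeriod k δ) = D := by
  have hk0 : 0 < k := by omega
  obtain ⟨m₁, hm₁⟩ := M.exists_forall_diffGcd_dvd hk0 htriv
  obtain ⟨m₂, hm₂⟩ := exists_forall_diffGcd_ne_zero hk htriv (δ := δ)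
  obtain ⟨g₀, hg₀⟩ := pathOutputs_nonempty hk0 htriv M M' c
  -- lengths in the class: `len K = c.val + K d`; shifting by `j d`
  have hlen : ∀ j K : ℕ, j * transducerPeriod k δ + (c.val + K * transducerPeriod k δ) =
      c.val + (j + K) * transducerPeriod k δ := fun j K => by ring
  -- the values `d_{g₀, c.val + K d}` for `K ≥ m₂` are positive; take the minimum
  have hne : ∃ v, ∃ K, m₂ ≤ K ∧ M.diffGcd k M' g₀ (c.val + K * transducerPeriod k δ) = v :=
    ⟨_, m₂, le_rfl, rfl⟩
  classical
  obtain ⟨K₀, hK₀, hD⟩ : ∃ K, m₂ ≤ K ∧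
      M.diffGcd k M' g₀ (c.val + K * transducerPeriod k δ) = Nat.find hne := Nat.find_spec hne
  set D := Nat.find hne with hDdef
  have hDmin : ∀ K, m₂ ≤ K → D ≤ M.diffGcd k M' g₀ (c.val + K * transducerPeriod k δ) :=
    fun K hK => Nat.find_min' hne ⟨K, hK, rfl⟩
  have hDpos : 0 < D := by
    rw [← hD]; exact Nat.pos_of_ne_zero (hm₂ M M' c g₀ hg₀ K₀ hK₀)
  refine ⟨D, hDpos, K₀ + m₁ + m₂, fun g hg K hK => ?_⟩
  obtain ⟨j, rfl⟩ : ∃ j, K = j + K₀ := ⟨K - K₀, by omega⟩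
  -- (1) `d_{g, len(j + K₀)} ∣ d_{g₀, len K₀} = D` since `j ≥ m₁`
  have h1 : M.diffGcd k M' g (c.val + (j + K₀) * transducerPeriod k δ) ∣ D := by
    rw [← hD, ← hlen]
    exact hm₁ M' c g g₀ hg hg₀ j (by omega) _
  -- (2) `D = d_{g₀, len(m₁ + j + K₀)} ∣ d_{g, len(j + K₀)}`
  have h3 : M.diffGcd k M' g₀ (c.val + (m₁ + (j + K₀)) * transducerPeriod k δ) ∣
      M.diffGcd k M' g (c.val + (j + K₀) * transducerPeriod k δ) := by
    rw [← hlen m₁]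
    exact hm₁ M' c g₀ g hg₀ hg m₁ le_rfl _
  have h4 : D ≤ M.diffGcd k M' g₀ (c.val + (m₁ + (j + K₀)) * transducerPeriod k δ) :=
    hDmin _ (by omega)
  have h5 : M.diffGcd k M' g₀ (c.val + (m₁ + (j + K₀)) * transducerPeriod k δ) ∣ D := by
    rw [← hD, show m₁ + (j + K₀) = (m₁ + j) + K₀ by ring, ← hlen]
    exact hm₁ M' c g₀ g₀ hg₀ hg₀ (m₁ + j) (by omega) _
  have h6 : M.diffGcd k M' g₀ (c.val + (m₁ + (j + K₀)) * transducerPeriod k δ) = D :=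
    le_antisymm (Nat.le_of_dvd hDpos h5) h4
  rw [h6] at h3
  exact Nat.dvd_antisymm h1 h3

end MinImage

end Literature.NumberTheory.LFunctions
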